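import Mathlib
import Summits.Ventures.PercRepro2.Defs
import Summits.Ventures.PercRepro2.Independence
import Summits.Ventures.PercRepro2.Harris
import Summits.Ventures.PercRepro2.Graph
import Summits.Ventures.PercRepro2.Events
import Summits.Ventures.PercRepro2.Induced
import Summits.Ventures.PercRepro2.BHKEvents
import Summits.Ventures.PercRepro2.ContractDefs
import Summits.Ventures.PercRepro2.CCTWRoot

/-!
# Row 2′CON-W, form (CCT-W): the FUNCTIONAL form (blind cell PercRepro2, mine-1 g28;
`conjectures/MINE-1.md` §39 (8))

(CCT-W) centres the two marker events `1[a ∈ C_s]`, `1[b ∈ C_s]` of the contracted graph `H/W` at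
the plain conditional means given `s ↮ t`.  The **functional form** replaces the two marker events
by ARBITRARY monotone functionals `F₁, F₂` of the cluster of the root — the analogue of BHK06's
passage from Theorem 1.2 (events) to Theorem 1.3 (functionals):

  `CCTWFun`:  `E_{H/W}[(F₁(C_s) − E_H[F₁(C_s) ∣ R_t]) (F₂(C_s) − E_H[F₂(C_s) ∣ R_t]); s ↛ t] ≥ 0`
  for all monotone `F₁, F₂ : Set V → R` (cleared by `P(R_t)²`),

where the cluster of `s` in `H/W` is read as the **merged cluster** `mergedCluster`: the cluster in
`contractEnds ends W w₀` completed by the whole of `W` when it contains the representative `w₀`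
(the census reading «`W` merged into one vertex»; with the isolated copies of `W ∖ {w₀}` left out the
statement is FALSE — 154 / 3,000 at `n = 6`).

* `CCTW_of_CCTWFun`: the functional form specialises to the row (`F_i = 1[a_i ∈ ·]`, markers
  outside `W`).
* Census (mine-1 g28, own code, exact, fine grid; one block `W`): `n = 6` open class, 250 cells ×
  12 random decreasing pairs (nonnegative combinations of avoidance indicators) 0 / 3,000, 3,000
  random down-set pairs 0 / 3,000, 600 product functionals + 600 avoidance indicators 0 / 1,200;
  `n = 7` `|W| = 2, 3` 0 / 600 each; `n = 8` `|W| = 4` 0 / 360.  Controls: non-monotone functionals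
  FAIL 1,378 / 3,000; TWO separate blocks FAIL (n = 8: 1 / 320) — the row's (TWO).
  Nothing about the sign is proved here; `CCTWFun` is a candidate lemma line of row 2′CON-W.
-/

namespace Summit.Ventures.PercRepro2

namespace Contract

section Merged

variable {V : Type*} {E : Type*} [DecidableEq V]

/-- **The merged cluster** of `s` in `H/W`: the cluster of `s` in `contractEnds ends W w₀`, completed
by the whole of `W` when it contains the representative `w₀` (so that it contains all of `W` or
none of it — the census reading of «`W` merged into one vertex»). -/
def mergedCluster (ends : E → Sym2 V) (W : Finset V) (w₀ : V) (ω : Config E) (s : V) : Set V :=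
  cluster (contractEnds ends W w₀) ω s ∪
    {v | v ∈ W ∧ w₀ ∈ cluster (contractEnds ends W w₀) ω s}

/-- A vertex outside `W` lies in the merged cluster iff it lies in the `H/W`-cluster. -/
lemma mem_mergedCluster_of_notMem (ends : E → Sym2 V) (W : Finset V) (w₀ : V) (ω : Config E)
    (s : V) {a : V} (ha : a ∉ W) :
    a ∈ mergedCluster ends W w₀ ω s ↔ a ∈ cluster (contractEnds ends W w₀) ω s := by
  simp only [mergedCluster, Set.mem_union, Set.mem_setOf_eq]
  constructor
  · rintro (h | ⟨haW, _⟩)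
    · exact h
    · exact absurd haW ha
  · exact Or.inl

end Merged

section Functional

variable {V : Type*} {E : Type*} [Fintype V] [DecidableEq V] [Fintype E] [DecidableEq E]
  {R : Type*} [Field R] [LinearOrder R] [IsStrictOrderedRing R]

omit [Fintype V] [Fintype E] [DecidableEq E] [Field R] [LinearOrder R] [IsStrictOrderedRing R] in
/-- «`s` reaches `a` and `b`» as a cluster event (two markers). -/
lemma connAll_union_singleton_eq (ends : E → Sym2 V) (s a b : V) :
    connAll ends s ({a} ∪ {b}) = clusterInEvent ends s {S : Set V | a ∈ S ∧ b ∈ S} := by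
  ext ω
  simp only [connAll, clusterInEvent, Set.mem_setOf_eq, Finset.mem_union, Finset.mem_singleton,
    mem_cluster]
  constructor
  · intro h
    exact ⟨h a (Or.inl rfl), h b (Or.inr rfl)⟩
  · rintro ⟨ha, hb⟩ x (rfl | rfl)
    · exact ha
    · exact hb

/-- **The functional form of (CCT-W)**, cleared by `P(R_t)²`: for all monotone functionals
`F₁, F₂ : Set V → R` of the cluster of the root `s`,
`E_{H/W}[(F₁(C_s) P(R_t) − E_H[F₁(C_s); R_t]) (F₂(C_s) P(R_t) − E_H[F₂(C_s); R_t]); s ↛ t] ≥ 0`,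
with `C_s` in `H/W` the merged cluster. -/
def CCTWFun (p : E → R) (ends : E → Sym2 V) (s t : V) (W : Finset V) (w₀ : V) : Prop :=
  ∀ F₁ F₂ : Set V → R, Monotone F₁ → Monotone F₂ →
    0 ≤ expect p (fun ω =>
      (F₁ (mergedCluster ends W w₀ ω s) * prob p (avoidAll ends s {t}) -
          expect p (fun ω' => F₁ (cluster ends ω' s) * ((connEvent ends s t)ᶜ).indicator 1 ω')) *
        (F₂ (mergedCluster ends W w₀ ω s) * prob p (avoidAll ends s {t}) -
          expect p (fun ω' => F₂ (cluster ends ω' s) * ((connEvent ends s t)ᶜ).indicator 1 ω')) *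
        ((connEvent (contractEnds ends W w₀) s t)ᶜ).indicator 1 ω)

omit [Fintype V] [Fintype E] [DecidableEq E] [LinearOrder R] [IsStrictOrderedRing R] in
/-- The indicator of `{S ∣ a ∈ S}` on the merged cluster is the indicator of the `H/W`-connection
event, for `a ∉ W`. -/
lemma indicator_mem_mergedCluster (ends : E → Sym2 V) (W : Finset V) (w₀ : V) (ω : Config E)
    (s : V) {a : V} (ha : a ∉ W) :
    ({S : Set V | a ∈ S}.indicator (1 : Set V → R) (mergedCluster ends W w₀ ω s)) =
      (clusterInEvent (contractEnds ends W w₀) s {S : Set V | a ∈ S}).indicator 1 ω := by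
  by_cases h : a ∈ cluster (contractEnds ends W w₀) ω s
  · have h1 : mergedCluster ends W w₀ ω s ∈ {S : Set V | a ∈ S} :=
      (mem_mergedCluster_of_notMem ends W w₀ ω s ha).2 h
    have h2 : ω ∈ clusterInEvent (contractEnds ends W w₀) s {S : Set V | a ∈ S} := h
    rw [Set.indicator_of_mem h1, Set.indicator_of_mem h2]
    rfl
  · have h1 : mergedCluster ends W w₀ ω s ∉ {S : Set V | a ∈ S} := fun hm =>
      h ((mem_mergedCluster_of_notMem ends W w₀ ω s ha).1 hm)
    have h2 : ω ∉ clusterInEvent (contractEnds ends W w₀) s {S : Set V | a ∈ S} := h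
    rw [Set.indicator_of_notMem h1, Set.indicator_of_notMem h2]

omit [Fintype V] [DecidableEq V] [LinearOrder R] [IsStrictOrderedRing R] in
/-- `E[1[a ∈ C_s] 1_{s↮t}] = P(a ∈ C_s; s ↮ t)`. -/
lemma expect_indicator_mem_cluster (p : E → R) (ends : E → Sym2 V) (s t a : V) :
    expect p (fun ω => {S : Set V | a ∈ S}.indicator (1 : Set V → R) (cluster ends ω s) *
        ((connEvent ends s t)ᶜ).indicator 1 ω) =
      prob p (connAll ends s {a} ∩ avoidAll ends s {t}) := by
  rw [connAll_singleton_eq, avoidAll_singleton_eq, prob_clusterInEvent_inter_eq_expect]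

omit [Fintype V] in
/-- **The functional form specialises to the row**: for markers `a, b ∉ W`,
`CCTWFun → CCTW p ends s {t} W w₀ a b`. -/
theorem CCTW_of_CCTWFun (p : E → R) (ends : E → Sym2 V) (s t : V) (W : Finset V) (w₀ : V)
    (hfun : CCTWFun p ends s t W w₀) {a b : V} (ha : a ∉ W) (hb : b ∉ W) :
    CCTW p ends s {t} W w₀ a b := by
  have hmono : ∀ c : V, Monotone ({S : Set V | c ∈ S}.indicator (1 : Set V → R)) := fun c =>
    monotone_indicator_one_of_isUpperSet (isUpperSet_memUp c)
  have key := hfun _ _ (hmono a) (hmono b)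
  set ends' := contractEnds ends W w₀ with hends'
  simp only [indicator_mem_mergedCluster ends W w₀ _ s ha, indicator_mem_mergedCluster ends W w₀ _ s hb,
    expect_indicator_mem_cluster] at key
  unfold CCTW
  rw [← hends']
  -- the four merged probabilities as expectations
  have eA : prob p (connAll ends' s ({a} ∪ {b}) ∩ avoidAll ends' s {t}) =
      expect p (fun ω => (clusterInEvent ends' s {S : Set V | a ∈ S}).indicator (1 : Config E → R) ω *
        (clusterInEvent ends' s {S : Set V | b ∈ S}).indicator 1 ω *
        ((connEvent ends' s t)ᶜ).indicator 1 ω) := by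
    rw [connAll_union_singleton_eq, avoidAll_singleton_eq, prob_eq_expect_indicator]
    unfold expect
    refine Finset.sum_congr rfl fun ω _ => ?_
    congr 1
    have e : clusterInEvent ends' s {S : Set V | a ∈ S ∧ b ∈ S} =
        clusterInEvent ends' s {S : Set V | a ∈ S} ∩ clusterInEvent ends' s {S : Set V | b ∈ S} := by
      ext ω'; simp [clusterInEvent]
    rw [e, indicator_inter_one, indicator_inter_one]
  have eX : ∀ c : V, prob p (connAll ends' s {c} ∩ avoidAll ends' s {t}) =
      expect p (fun ω => (clusterInEvent ends' s {S : Set V | c ∈ S}).indicator (1 : Config E → R) ω *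
        ((connEvent ends' s t)ᶜ).indicator 1 ω) := by
    intro c
    rw [connAll_singleton_eq, avoidAll_singleton_eq, prob_eq_expect_indicator]
    unfold expect
    refine Finset.sum_congr rfl fun ω _ => ?_
    congr 1
    rw [indicator_inter_one]
  have eQ : prob p (avoidAll ends' s {t}) =
      expect p (fun ω => ((connEvent ends' s t)ᶜ).indicator (1 : Config E → R) ω) := by
    rw [avoidAll_singleton_eq, prob_eq_expect_indicator]
  rw [eA, eX a, eX b, eQ]
  -- the functional expectation expands to the cleared form
  have expand : expect p (fun ω =>
      ((clusterInEvent ends' s {S : Set V | a ∈ S}).indicator (1 : Config E → R) ω *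
            prob p (avoidAll ends s {t}) - prob p (connAll ends s {a} ∩ avoidAll ends s {t})) *
        ((clusterInEvent ends' s {S : Set V | b ∈ S}).indicator (1 : Config E → R) ω *
            prob p (avoidAll ends s {t}) - prob p (connAll ends s {b} ∩ avoidAll ends s {t})) *
        ((connEvent ends' s t)ᶜ).indicator 1 ω) =
      prob p (avoidAll ends s {t}) ^ 2 *
          expect p (fun ω => (clusterInEvent ends' s {S : Set V | a ∈ S}).indicator (1 : Config E → R) ω *
            (clusterInEvent ends' s {S : Set V | b ∈ S}).indicator 1 ω *
            ((connEvent ends' s t)ᶜ).indicator 1 ω) -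
        prob p (avoidAll ends s {t}) *
          (prob p (connAll ends s {a} ∩ avoidAll ends s {t}) *
              expect p (fun ω => (clusterInEvent ends' s {S : Set V | b ∈ S}).indicator (1 : Config E → R) ω *
                ((connEvent ends' s t)ᶜ).indicator 1 ω) +
            prob p (connAll ends s {b} ∩ avoidAll ends s {t}) *
              expect p (fun ω => (clusterInEvent ends' s {S : Set V | a ∈ S}).indicator (1 : Config E → R) ω *
                ((connEvent ends' s t)ᶜ).indicator 1 ω)) +
        prob p (connAll ends s {a} ∩ avoidAll ends s {t}) *
          prob p (connAll ends s {b} ∩ avoidAll ends s {t}) *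
          expect p (fun ω => ((connEvent ends' s t)ᶜ).indicator (1 : Config E → R) ω) := by
    simp only [expect, Finset.mul_sum, ← Finset.sum_sub_distrib, ← Finset.sum_add_distrib]
    refine Finset.sum_congr rfl fun ω _ => ?_
    ring
  rw [expand] at key
  exact key

end Functional

end Contract

end Summit.Ventures.PercRepro2
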